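import Mathlib
import Literature.Analysis.ODE.FirstOrderLinearRightInverse
import HarnessLib

/-!
# Vanishing order at the base point of the integrating-factor right inverse

Analysis/ODE support file (everything proved). For the right inverse
`v(x) = e^{I(x)} ∫_a^x e^{−I} w` of `f ↦ f' − c f` (`I' = c`, `FirstOrderLinearRightInverse.lean`)
based at `a`: if `w^{(i)}(a) = 0` for `i < j` then `v^{(i)}(a) = 0` for `i ≤ j` and
`v^{(j+1)}(a) = w^{(j)}(a)` (`iteratedDeriv_integratingFactor_vanishing`) — each rung of the inverse
Darboux ladder raises the vanishing order at the base point by one and passes the leading Taylor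
coefficient through. Consequence used downstream: the pre-image `h̃ = R_1 ⋯ R_ℓ h` of far-field data
vanishes to order `ℓ − 1` at `a` with `h̃^{(ℓ)}(a) = h(a)`, so that `h̃ − h(a)(x−a)^ℓ/ℓ!` satisfies the
hypotheses of the Hardy chain (`HardyChainHalfLine.lean`) and only ONE kernel direction survives
(route PhotonSphereChannels, `FixedModeChannels`, far side, stmt-FinalStateConjecture-10048).
Also: the Leibniz consequence `iteratedDeriv i (g·u)(a) = 0` when `u` vanishes to order `i` at `a`.
Folklore.
-/

noncomputable section

namespace Literature.Analysis.ODE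

open Set Filter Topology intervalIntegral

/-- If `u^{(r)}(a) = 0` for all `r ≤ i` then `(g u)^{(i)}(a) = 0` (Leibniz). [folklore] -/
theorem iteratedDeriv_mul_eq_zero_of_vanishing {g u : ℝ → ℝ} {a : ℝ} {i : ℕ}
    (hg : ContDiffAt ℝ i g a) (hu : ContDiffAt ℝ i u a) (h0 : ∀ r ≤ i, iteratedDeriv r u a = 0) :
    iteratedDeriv i (fun x => g x * u x) a = 0 := by
  rw [iteratedDeriv_fun_mul hg hu]
  refine Finset.sum_eq_zero fun r hr => ?_
  rw [h0 (i - r) (Nat.sub_le i r), mul_zero]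

variable {c I w : ℝ → ℝ} {a : ℝ}

/-- **Vanishing order through one inverse rung.** Let `I' = c` with `I ∈ C^{m+1}`, `w ∈ C^m`,
`j ≤ m`, and `v(x) = e^{I x}∫_a^x e^{−I} w`. If `w^{(i)}(a) = 0` for `i < j`, then `v^{(i)}(a) = 0`
for `i ≤ j` and `v^{(j+1)}(a) = w^{(j)}(a)`. [folklore] -/
theorem iteratedDeriv_integratingFactor_vanishing {m j : ℕ} (hI : ContDiff ℝ (m + 1) I)
    (hI' : ∀ x, HasDerivAt I (c x) x) (hw : ContDiff ℝ m w) (hjm : j ≤ m)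
    (hw0 : ∀ i < j, iteratedDeriv i w a = 0) :
    (∀ i ≤ j, iteratedDeriv i (fun x => Real.exp (I x) * ∫ y in a..x, Real.exp (-I y) * w y) a = 0)
    ∧ iteratedDeriv (j + 1) (fun x => Real.exp (I x) * ∫ y in a..x, Real.exp (-I y) * w y) a
        = iteratedDeriv j w a := by
  set v : ℝ → ℝ := fun x => Real.exp (I x) * ∫ y in a..x, Real.exp (-I y) * w y with hv
  have hvC : ContDiff ℝ (m + 1) v := contDiff_integratingFactor hI hw a
  have hvd : ∀ x, HasDerivAt v (c x * v x + w x) x := fun x =>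
    hasDerivAt_integratingFactor hI' hw.continuous a x
  have hcC : ContDiff ℝ m c := by
    have h := (contDiff_succ_iff_deriv.1 hI).2.2
    have : deriv I = c := funext fun x => (hI' x).deriv
    rwa [this] at h
  have hderiv : deriv v = fun x => c x * v x + w x := funext fun x => (hvd x).deriv
  have hvm : ContDiff ℝ m v := hvC.of_le (by exact_mod_cast Nat.le_succ m)
  -- `v^{(i+1)}(a) = (c v)^{(i)}(a) + w^{(i)}(a)` for `i ≤ m`
  have hstep : ∀ i ≤ m, iteratedDeriv (i + 1) v a
      = iteratedDeriv i (fun x => c x * v x) a + iteratedDeriv i w a := by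
    intro i hi
    rw [iteratedDeriv_succ', hderiv]
    have h1 : ContDiffAt ℝ i (fun x => c x * v x) a :=
      ((hcC.mul hvm).of_le (by exact_mod_cast hi)).contDiffAt
    have h2 : ContDiffAt ℝ i w a := (hw.of_le (by exact_mod_cast hi)).contDiffAt
    exact iteratedDeriv_fun_add h1 h2
  have hv0 : v a = 0 := by simp [hv]
  -- Claim A: vanishing up to order `j`
  have hA : ∀ i ≤ j, ∀ r ≤ i, iteratedDeriv r v a = 0 := by
    intro i hi
    induction i with
    | zero => intro r hr; rw [Nat.le_zero.1 hr]; simpa using hv0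
    | succ i ih =>
      intro r hr
      rcases Nat.lt_or_ge r (i + 1) with hlt | hge
      · exact ih (Nat.le_of_succ_le hi) r (Nat.lt_succ_iff.1 hlt)
      · have hri : r = i + 1 := le_antisymm hr hge
        subst hri
        have him : i ≤ m := by omega
        rw [hstep i him, hw0 i (by omega), add_zero]
        have hc' : ContDiffAt ℝ i c a := (hcC.of_le (by exact_mod_cast him)).contDiffAt
        have hv' : ContDiffAt ℝ i v a := (hvm.of_le (by exact_mod_cast him)).contDiffAt
        exact iteratedDeriv_mul_eq_zero_of_vanishing hc' hv' (ih (Nat.le_of_succ_le hi))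
  refine ⟨fun i hi => hA i hi i le_rfl, ?_⟩
  -- Claim B
  rw [hstep j hjm]
  have hc' : ContDiffAt ℝ j c a := (hcC.of_le (by exact_mod_cast hjm)).contDiffAt
  have hv' : ContDiffAt ℝ j v a := (hvm.of_le (by exact_mod_cast hjm)).contDiffAt
  rw [iteratedDeriv_mul_eq_zero_of_vanishing hc' hv' (hA j le_rfl), zero_add]

end Literature.Analysis.ODE
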